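import Summits.QuantumFields.YangMills.Theorems.BalabanUVNodesN07Letters10OfRealRows

/-!
# BalabanUVNodes ∕ N07 — [15] (164) ⇒ (165) AT A WINDOW OF NEAR-TOP CELLS: the S5 → S6 junction `letters10On_of_weightedRowsTop` (p600098) with the window allowed to
# carry cells of level `≥ k − ℓ` of the family (the BOUNDARY DATUMS of the S6 head, whose print box lies over the levels `k` and `k − 1` of the per-cube family
# `D″ = cubeDomains ⊓ shrink (domainsOfSeq s)`), at the price `L^{4ℓ}` in the threshold

Cell `pub-ymgap`, width seat `pub-ymgap-dag-n07-w4` gen 3 (director-ym №197 ∕ HUMAN RULING D-0149); node N07 = [15] = [Balaban1985Variational]; [B6-II] = [Balaban1984PropagatorsII];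
CLAIM-4 ∕ INTENT-4 of 2026-08-28 (bus I.31196; n07-e ANSWER «Q-CUBE-TOP» I.30724 «near cells at BOTH levels i and i−1 in the top cube»).  NEW Theorems-side leaf
(`--supports stmt-QuantumFields-20542 --as helper`; theorems only); CONSUMED BY NAME, nothing modified: this seat's p600098 `…N07Letters10OfRealRows` (`letters10On_of_realRows`,
`Letters10On`), UST's `K0FlatCubeOpsTextP.IsLevWeight`, `FlatCubeLevels.levOf_inOm_le`, lit-balaban's `B11Eq115Space.levOf ∕ le_levOf`, `B6SectADomainsV1.Domains`.  COUNT-NEUTRAL.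

WHY.  The S5 sockets (k0-s1-w3) deliver the three rows of (164) for the real fields `φ ∘ HB` in print's WEIGHTED norms (p. 286: the weights `(L^{j(b₋)}η)^m` of the level
`j(b₋)` of the bond's base point in the per-cube family), and p600098's junction turns them into the plain letters of the S6 clause on a window of TOP-LEVEL cells, where all
weights are `1`.  At a BOUNDARY DATUM of the S6 head (this seat's LOCATED-BOUNDARY-DATUM, bus I.30627; n07-e's ANSWER I.30724 and INTERFACE-BONDS line: the per-cube family there
is the meet `D″ = cubeDomains ⊓ shrink (domainsOfSeq s)`, print's (150) «Ω′_j = □_j, j < k, Ω′_k = □″_k»), the window `π '' box(propCubeP k M ρ a)` carries cells of level `k`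
(over `Ω_k`) AND `k − 1` (off it): there the weights are `L^{−m} < 1` and the weighted rows bound the plain letters at unit `η_k` only up to powers of `L`.  THIS FILE is the
junction for windows of cells of level `≥ k − ℓ`: a cell of level `≥ k − ℓ` has weight `w_m ≥ L^{−ℓm}` (§1), so the products `w₁², w₁w₂, w₁w₃ ≥ L^{−4ℓ}` and the three weighted
rows at `Q` give the plain rows at `L^{4ℓ}·Q` (§2), whence `Letters10On Y η_k t 𝔄` for `t > L^{4ℓ}·q` by p600098's duality socket (§3).  `ℓ = 0` is p600098 verbatim; `ℓ = 1` is the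
boundary-datum window; the factor `L^{4ℓ}` joins the constants of the (165) budget (print's (162) «B₃ = 72d³L³B₀ …» carries such powers already).

CONTENTS.  §1 `levWeightP_pos` · `levWeightP_le_one` · ★ `pow_inv_le_levWeightP_of_inOm` (generic `D : Domains P`, `IsLevWeight P k D w`; no `D.k = k` needed).  §2 ★ `rows_nearTop_of_weightedRows`.  §3 ★★★ `letters10On_of_weightedRowsNearTop`.

HONEST FRAMING: count-neutral kernel bookkeeping (real inequalities on the level weights + p600098's socket by name); NOTHING of [15] Sect. F asserted or proved; the rows (164), the
data sizes and the per-cube family are other seats' rows; tokens ∕ `stub_prop8StepCoP13` ∕ K0⁷ ∕ K1⁷ NOT closed; N07 NOT discharged; counts unmoved (28∕28 · 5∕27); one finite 𝕋⁴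
programme at fixed ε — R4 closes the conditional finite-𝕋⁴ rung `BalabanLadder.UV` ONLY; the YM mass gap (Clay) is NOT proved by any of this; nothing continuum ∕ ℝ⁴ ∕ OS.
No `def`, no `instance`, no `notation`, no `sorry`.
-/

noncomputable section

open scoped BigOperators Matrix.Norms.L2Operator

namespace Summit.QuantumFields.YangMills.BalabanUVNodes.N07Letters10OfWeightedRowsNearTop

open Literature.MathematicalPhysics.QuantumFieldTheory.Balaban1983to89
open Literature.MathematicalPhysics.QuantumFieldTheory.Balaban1983to89.Node00
open B6SectAOperatorsV1 (dcE dcsE)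
open Summit.QuantumFields.YangMills.BalabanUVNodes.N07HalvingStepTopOfLocalLetters (Letters10On)
open Summit.QuantumFields.YangMills.BalabanUVNodes.N07Letters10OfRealRows (letters10On_of_realRows)
open Summit.QuantumFields.YangMills.Theorems.K0FlatCubeOpsTextP (IsLevWeight)
open Summit.QuantumFields.YangMills.Theorems.FlatCubeLevels (levOf_inOm_le)
open B6SectADomainsV1 (Domains)
open B11Eq115Space (levOf le_levOf)

variable {P : Params} {N : ℕ}

/-! ## §1  The level weights of near-top cells -/

section Weights

variable {D : Domains P} {k : ℕ} {w : ℕ → PBond P 0 → ℝ}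

/-- The level weights are positive (`L ≥ 1`). [cite: Balaban1985Variational, p.286 (bookkeeping)] -/
theorem levWeightP_pos (hw : IsLevWeight P k D w) (m : ℕ) (b : PBond P 0) : 0 < w m b := by
  rw [hw m b]
  have hL : (0 : ℝ) < P.L := by exact_mod_cast P.L_pos
  positivity

/-- The level weights are at most `1` (the level of a cell is at most the top level `k`). [cite: Balaban1985Variational, p.286 (bookkeeping)] -/
theorem levWeightP_le_one (hw : IsLevWeight P k D w) (m : ℕ) (b : PBond P 0) : w m b ≤ 1 := by
  rw [hw m b]
  have hL : (1 : ℝ) ≤ P.L := by exact_mod_cast P.L_pos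
  have hlev : levOf (fun j => {x : Site P 0 | D.InOm j x}) k b.src ≤ k := B11Eq115Space.levOf_le _ _ _
  have hbase : (P.L : ℝ) ^ levOf (fun j => {x : Site P 0 | D.InOm j x}) k b.src * ((P.L : ℝ)⁻¹) ^ k ≤ 1 := by
    rw [inv_pow, ← div_eq_mul_inv, div_le_one (by positivity)]
    exact pow_le_pow_right₀ hL hlev
  have hbase0 : 0 ≤ (P.L : ℝ) ^ levOf (fun j => {x : Site P 0 | D.InOm j x}) k b.src * ((P.L : ℝ)⁻¹) ^ k := by positivity
  exact pow_le_one₀ hbase0 hbase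

/-- ★ **A CELL OF LEVEL `≥ k − ℓ` HAS WEIGHT `≥ L^{−ℓm}`**: if the base point of `b` lies in `Ω_{k−ℓ}` of the family (`D.InOm (k − ℓ) b.src`, `ℓ ≤ k`), then `((Lˡ)⁻¹)^m ≤ w_m(b)` —
the weight `(L^{j(b₋)}·L^{−k})^m` with `j(b₋) ≥ k − ℓ`. [cite: Balaban1985Variational, p.286; Balaban1984PropagatorsII, (2.3)–(2.4) p.224] -/
theorem pow_inv_le_levWeightP_of_inOm (hw : IsLevWeight P k D w) {ℓ : ℕ} (hℓ : ℓ ≤ k) {b : PBond P 0} (hb : D.InOm (k - ℓ) b.src) (m : ℕ) :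
    (((P.L : ℝ) ^ ℓ)⁻¹) ^ m ≤ w m b := by
  rw [hw m b]
  have hL : (1 : ℝ) ≤ P.L := by exact_mod_cast P.L_pos
  have hL0 : (0 : ℝ) < P.L := by exact_mod_cast P.L_pos
  have hlev : k - ℓ ≤ levOf (fun j => {x : Site P 0 | D.InOm j x}) k b.src := le_levOf (Nat.sub_le k ℓ) hb
  -- `(Lˡ)⁻¹ = L^{k−ℓ}·(Lᵏ)⁻¹ ≤ L^{j(b₋)}·(Lᵏ)⁻¹`
  have hsplit : ((P.L : ℝ) ^ ℓ)⁻¹ = (P.L : ℝ) ^ (k - ℓ) * ((P.L : ℝ)⁻¹) ^ k := by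
    rw [inv_pow]
    have hk : (P.L : ℝ) ^ k = (P.L : ℝ) ^ (k - ℓ) * (P.L : ℝ) ^ ℓ := by rw [← pow_add, Nat.sub_add_cancel hℓ]
    rw [hk, mul_inv, ← mul_assoc, mul_inv_cancel₀ (pow_ne_zero _ hL0.ne'), one_mul]
  have hbase : ((P.L : ℝ) ^ ℓ)⁻¹ ≤ (P.L : ℝ) ^ levOf (fun j => {x : Site P 0 | D.InOm j x}) k b.src * ((P.L : ℝ)⁻¹) ^ k := by
    rw [hsplit]
    exact mul_le_mul_of_nonneg_right (pow_le_pow_right₀ hL hlev) (by positivity)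
  exact pow_le_pow_left₀ (by positivity) hbase m

end Weights

/-! ## §2  Weighted rows at a near-top cell bound the plain rows up to `L^{4ℓ}` -/

section Rows

variable {D : Domains P} {k : ℕ} {w : ℕ → PBond P 0 → ℝ}

/-- Elementary: `c⁴·x ≤ w·(w′·x)` for `0 < c ≤ 1`, `c ≤ w`, `cʲ ≤ w′` (`j ≤ 3`), `x ≥ 0`; hence `w·(w′·x) ≤ Q ⇒ x ≤ Q·c⁻⁴`. [folklore] -/
private theorem le_mul_inv_pow_four {c w w' x Q : ℝ} (hc : 0 < c) (hc1 : c ≤ 1) (hw : c ≤ w) {j : ℕ} (hj : j ≤ 3) (hw' : c ^ j ≤ w') (hx : 0 ≤ x)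
    (h : w * (w' * x) ≤ Q) : x ≤ Q * (c⁻¹) ^ 4 := by
  have hc4 : c ^ 4 ≤ c * c ^ j := by
    calc c ^ 4 ≤ c ^ (1 + j) := pow_le_pow_of_le_one hc.le hc1 (by omega)
      _ = c * c ^ j := by rw [pow_add, pow_one]
  have hww : c * c ^ j ≤ w * w' := mul_le_mul hw hw' (pow_nonneg hc.le j) (hc.le.trans hw)
  have hmain : c ^ 4 * x ≤ Q := by
    calc c ^ 4 * x ≤ w * w' * x := mul_le_mul_of_nonneg_right (hc4.trans hww) hx
      _ = w * (w' * x) := by ring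
      _ ≤ Q := h
  have hc4pos : 0 < c ^ 4 := pow_pos hc 4
  rw [inv_pow, ← div_eq_mul_inv, le_div_iff₀ hc4pos]
  linarith [mul_comm x (c ^ 4)]

/-- ★ **THE WEIGHTED ROWS OF (164) AT A CELL OF LEVEL `≥ k − ℓ` GIVE THE PLAIN ROWS AT `L^{4ℓ}·Q`**: at a fine bond `b` with `b₋ ∈ Ω_{k−ℓ}` of the family, the S5 socket's
three weighted rows `w₁(b)·(w₁(b)·|F(b)|) ≤ Q`, `w₁(b)·(w₂(b)·Lᵏ·|F(b₋ + e_ν, b_dir) − F(b)|) ≤ Q`, `w₁(b)·(w₃(b)·|(∂*∂F)(b)|) ≤ Q` give `|F(b)|`, `Lᵏ·|F(b₋ + e_ν, b_dir) − F(b)|`,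
`|(∂*∂F)(b)|` all `≤ L^{4ℓ}·Q` (weights `≥ L^{−ℓ}, L^{−2ℓ}, L^{−3ℓ}`; `ℓ = 0`: p600098's `rows_top_of_weightedRows`).
[cite: Balaban1985Variational, (164) p.304, p.286; Balaban1984PropagatorsII, (2.19) p.226] -/
theorem rows_nearTop_of_weightedRows (hw : IsLevWeight P k D w) {ℓ : ℕ} (hℓ : ℓ ≤ k) {b : PBond P 0} (hb : D.InOm (k - ℓ) b.src)
    {F : PBond P 0 → ℝ} {Q : ℝ}
    (h1 : w 1 b * (w 1 b * |F b|) ≤ Q)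
    (h2 : ∀ ν : Fin P.d, w 1 b * (w 2 b * (P.L : ℝ) ^ k * |F ⟨b.src.shift ν, b.dir⟩ - F b|) ≤ Q)
    (h3 : w 1 b * (w 3 b * |(dcsE ((P.L : ℝ) ^ k) (dcE ((P.L : ℝ) ^ k) (WithLp.toLp 2 F))) b|) ≤ Q) :
    |F b| ≤ (P.L : ℝ) ^ (4 * ℓ) * Q ∧ (∀ ν : Fin P.d, (P.L : ℝ) ^ k * |F ⟨b.src.shift ν, b.dir⟩ - F b| ≤ (P.L : ℝ) ^ (4 * ℓ) * Q) ∧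
      |(dcsE ((P.L : ℝ) ^ k) (dcE ((P.L : ℝ) ^ k) (WithLp.toLp 2 F))) b| ≤ (P.L : ℝ) ^ (4 * ℓ) * Q := by
  have hL : (1 : ℝ) ≤ P.L := by exact_mod_cast P.L_pos
  set c : ℝ := ((P.L : ℝ) ^ ℓ)⁻¹ with hc
  have hc0 : 0 < c := by rw [hc]; positivity
  have hc1 : c ≤ 1 := by rw [hc]; exact inv_le_one_of_one_le₀ (one_le_pow₀ hL)
  have hw1 : c ≤ w 1 b := by simpa [hc] using pow_inv_le_levWeightP_of_inOm hw hℓ hb 1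
  have hw2 : c ^ 2 ≤ w 2 b := by simpa [hc] using pow_inv_le_levWeightP_of_inOm hw hℓ hb 2
  have hw3 : c ^ 3 ≤ w 3 b := by simpa [hc] using pow_inv_le_levWeightP_of_inOm hw hℓ hb 3
  have hcQ : Q * (c⁻¹) ^ 4 = (P.L : ℝ) ^ (4 * ℓ) * Q := by
    rw [hc, inv_inv, ← pow_mul, mul_comm ℓ 4, mul_comm]
  refine ⟨?_, fun ν => ?_, ?_⟩
  · rw [← hcQ]
    exact le_mul_inv_pow_four hc0 hc1 hw1 (j := 1) (by norm_num) (by simpa using hw1) (abs_nonneg _) h1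
  · rw [← hcQ]
    have h2' : w 1 b * (w 2 b * ((P.L : ℝ) ^ k * |F ⟨b.src.shift ν, b.dir⟩ - F b|)) ≤ Q := by simpa only [mul_assoc] using h2 ν
    exact le_mul_inv_pow_four hc0 hc1 hw1 (j := 2) (by norm_num) hw2 (by positivity) h2'
  · rw [← hcQ]
    exact le_mul_inv_pow_four hc0 hc1 hw1 (j := 3) le_rfl hw3 (abs_nonneg _) h3

end Rows

/-! ## §3  ★★★ The S5 → S6 junction on a window of near-top cells -/

section Junction

variable {D : Domains P} {k : ℕ} {w : ℕ → PBond P 0 → ℝ}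

/-- ★★★ **THE S5 → S6 SOCKET FOR THE `HB` SUMMAND ON A WINDOW OF NEAR-TOP CELLS** (the boundary-datum edition of p600098's `letters10On_of_weightedRowsTop`): let `D` be a nested
family of height `k` with its P2 level weights `w`, `Y` a window of sites of level `≥ k − ℓ` (`D.InOm (k − ℓ) x` for `x ∈ Y`; at a boundary datum of the S6 head `ℓ = 1`: the print box
lies over `Ω_k` and `Ω_{k−1} ∖ Ω_k` of the per-cube family), `𝔄` a matrix bond field, `0 ≤ q`, `L^{4ℓ}·q < t`.  If for every functional of the duality class and every bond based in
`Y` the three WEIGHTED rows of (164) hold for the real field `φ ∘ 𝔄` at `q` (verbatim the shape k0-s1-w3's sockets deliver), then `Letters10On Y η_k t 𝔄` — the `HB` (resp. any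
summand) input of the S6 assembly `localGauge10On_of_eq159` ∕ `localGaugeSplitOn_of_(gauge152_)eq159`.  `ℓ = 0` is p600098 verbatim.
[cite: Balaban1985Variational, (164)–(165) p.304, (150) p.301, p.286; Balaban1984PropagatorsII, (2.3)–(2.4) p.224, (2.19) p.226; Balaban1985RegularSpaces, (1.2) p.76] -/
theorem letters10On_of_weightedRowsNearTop [NeZero N] (hw : IsLevWeight P k D w) {ℓ : ℕ} (hℓ : ℓ ≤ k) {Y : Set (Site P 0)}
    (hY : ∀ x ∈ Y, D.InOm (k - ℓ) x) {q t : ℝ} (hq : 0 ≤ q) (hqt : (P.L : ℝ) ^ (4 * ℓ) * q < t) {𝔄 : PBond P 0 → MatA N}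
    (hrows : ∀ (f : StrongDual ℂ (MatA N)) (u : ℂ) (r : ℝ), (∀ y : MatA N, |r * (u * f y).re| ≤ ‖y‖) →
      ∀ b : PBond P 0, b.src ∈ Y →
        w 1 b * (w 1 b * |r * (u * f (𝔄 b)).re|) ≤ q ∧
        (∀ ν : Fin P.d, w 1 b * (w 2 b * (P.L : ℝ) ^ k * |r * (u * f (𝔄 ⟨b.src.shift ν, b.dir⟩)).re - r * (u * f (𝔄 b)).re|) ≤ q) ∧
        w 1 b * (w 3 b * |(dcsE ((P.L : ℝ) ^ k) (dcE ((P.L : ℝ) ^ k) (WithLp.toLp 2 fun b' => r * (u * f (𝔄 b')).re))) b|) ≤ q) :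
    Letters10On Y (P.eta k) t 𝔄 := by
  have hη : 0 < P.eta k := by
    unfold Params.eta
    exact pow_pos (inv_pos.mpr (by exact_mod_cast P.L_pos)) k
  have hηinv : (P.eta k)⁻¹ = (P.L : ℝ) ^ k := by
    unfold Params.eta
    rw [inv_pow, inv_inv]
  have hq' : 0 ≤ (P.L : ℝ) ^ (4 * ℓ) * q := by positivity
  refine letters10On_of_realRows hη hq' hqt fun f u r hf b hb => ?_
  obtain ⟨h1, h2, h3⟩ := hrows f u r hf b hb
  obtain ⟨h1', h2', h3'⟩ := rows_nearTop_of_weightedRows hw hℓ (hY b.src hb) (F := fun b' => r * (u * f (𝔄 b')).re) h1 h2 h3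
  refine ⟨h1', fun κ => ?_, ?_⟩
  · rw [hηinv]
    exact h2' κ
  · rw [hηinv]
    exact h3'

end Junction

end Summit.QuantumFields.YangMills.BalabanUVNodes.N07Letters10OfWeightedRowsNearTop

end
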